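import Summits.ValiantsHypothesis.ValiantsHypothesis.Theorems.KPlusLogSqLawWeakLiftingTowerGraftTowerRowTwoSymDefs

/-!
# Tower graft line — THE SYMMETRIC `m = 2` TROPICAL OPTIMUM `3K − 4` IS ATTAINED ON EVERY 2-TOWER; hence
# `ζ₊(2; d) ≥ 3K − 4` for every 2-tower `d` (the tower floor of the `m = 2` rung rises from `2K − 2` to `3K − 4`)

Helper/calibration file for LINE (B) `Cruxes/WeakLifting/Lines/tower_graft.lean` of the crux `WeakLifting` (stmt-ValiantsHypothesis-19561),
`m = 2` rung of S5 (`…TowerGraftRowTwoRung`: the rung is the growth order of the tower row `K ↦ sup_{2-towers d} ζ₊(2; d)`; a linear cap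
`ζ₊(2; d) ≤ cK` on towers gives it).  NO stub is claimed.  Data and closed forms: `…TowerGraftTowerRowTwoSymDefs`.

For EVERY 2-tower `d` with `K ≥ 3` letters the symmetric `2 × 2` dominance design of the Defs file has `3K − 4` sign-alternating uniquely
dominant breakpoints — the symmetric tropical maximum (`tropRow_two_symm_le`: `T_sym(2,K) ≤ 3K − 4` on every support; the tree's witnesses
`SymmetricTwoK` / the general `4K − 7` family live on the near-arithmetic support `4K²·l + l²`, NOT a tower).  Dominance is certified by the
ENVELOPE (CHORD) CRITERION `EnvelopeCriterion.isDominant_of_envelope` (p817916; the parabola criterion cannot serve a tower: unbounded slope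
gaps): every present off-chain term lies strictly above a chord of the chain (`off_chain`, five cases, each a comparison of telescoped cost
bounds `4^{j+1}(X_k − X_j) ≤ Cst k − Cst j ≤ 4ᵏ(X_k − X_j)` at different epochs).  Symmetric patchworking (`le_card_posRoots_patchMatrix`,
`patchMatrix_isSymm`) turns the chain into a real SYMMETRIC pencil on the SAME support:

* `exists_symm_chain` — the certified symmetric chain of `3K − 3` terms on every 2-tower;
* ★ `not_posRootLawOn_two_tower` — `¬ PosRootLawOn 2 K (3K − 5) d`; `le_of_posRootLawOn_two_tower` — every valid size-`2` class budget on a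
  2-tower has `3K − 4 ≤ B` (the tree's all-support floor was the diagonal `2K − 2`, `DescartesSharp.le_of_posRootLawOn`).

So the `m = 2` tower row is pinned to `3K − 4 ≤ ζ₊(2; d) ≤ C(K+1,2) − 1`, a linear tower cap needs `c ≥ 3`, and towers are NOT poorer than
general supports for symmetric tropical designs at `m = 2`.  HONEST FRAMING: a lower-bound construction; nothing on S4/S4b/S5/S5ᴸ, TowerB,
`WeakLifting`, Conjecture B, `MatrixDescartes` (18050) or `VP ≠ VNP`.  Def-free.  Seat: prover leafhand-val-kpluslogsqlaw-1 g3,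
`--supports stmt-ValiantsHypothesis-19561`.  [folklore] lower convex hulls / Viro patchworking; the design is this seat's.
-/

set_option linter.dupNamespace false
set_option autoImplicit false

namespace Summit.ValiantsHypothesis.ValiantsHypothesis.Theorems.KPlusLogSqLaw.TowerGraft

open Summit.ValiantsHypothesis.ValiantsHypothesis.Theorems.MatrixDescartes.Negative
open Summit.ValiantsHypothesis.ValiantsHypothesis.Theorems.LacunarySymmetroidMatrixDescartes
open Summit.ValiantsHypothesis.ValiantsHypothesis.Theorems.LacunarySymmetroidMatrixDescartes.TropicalCensus
open Summit.ValiantsHypothesis.ValiantsHypothesis.Theorems.KPlusLogSqLaw.EnvelopeCriterion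
open Summit.ValiantsHypothesis.ValiantsHypothesis.Theorems.KPlusLogSqLaw.TwoRowFamily (perm_two)
open Finset Polynomial

namespace TowerRowTwoSym

variable {K : ℕ}

/-! ## 1. The chain terms: slopes, costs, signs -/

section chain
variable (hK : 3 ≤ K) (d : Fin K → ℕ)

/-- the permutation of chain term `k`. -/
theorem term_fst (k : Fin (3 * K - 4 + 1)) : (term K hK k).1 = perm K k := rfl
/-- column-`0` class of chain term `k`. -/
theorem term_cls0 (k : Fin (3 * K - 4 + 1)) : (((term K hK k).2 0 : Fin K) : ℕ) = cls0 K k := rfl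
/-- column-`1` class of chain term `k`. -/
theorem term_cls1 (k : Fin (3 * K - 4 + 1)) : (((term K hK k).2 1 : Fin K) : ℕ) = cls1 K k := rfl

include hK in
/-- a term with the chain's permutation and classes IS the chain term. -/
theorem eq_term (q : Equiv.Perm (Fin 2) × (Fin 2 → Fin K)) (k : ℕ) (hk : k ≤ 3 * K - 4)
    (h1 : q.1 = perm K k) (h0 : ((q.2 0 : Fin K) : ℕ) = cls0 K k) (h1' : ((q.2 1 : Fin K) : ℕ) = cls1 K k) :
    q = term K hK ⟨k, by omega⟩ := by
  refine Prod.ext h1 (funext fun i => ?_)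
  fin_cases i
  · exact Fin.ext h0
  · exact Fin.ext h1'

/-- slope of chain term `k` is `X k`. -/
theorem slope_term (k : Fin (3 * K - 4 + 1)) : TropicalCensus.slope d (term K hK k) = X K d k := by
  rw [slope_two]
  show dN K d (cls0 K k) + dN K d (cls1 K k) = X K d k
  unfold cls0 cls1 X
  by_cases h : 2 * K ≤ (k : ℕ) + 3
  · simp only [if_pos h]
  · simp only [if_neg h]
    by_cases ho : (k : ℕ) % 2 = 1
    · simp only [if_pos ho]
    · simp only [if_neg ho]; ring

/-- cost of chain term `k` is `Cst k`. -/
theorem cost_term (k : Fin (3 * K - 4 + 1)) : ∑ i, vv K d ((term K hK k).1 i) i ((term K hK k).2 i) = Cst K d k := by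
  have hk : (k : ℕ) ≤ 3 * K - 4 := by have := k.isLt; omega
  by_cases hsw : ¬ (2 * K ≤ (k : ℕ) + 3) ∧ (k : ℕ) % 2 = 0 ∧ (k : ℕ) ≠ 0
  · have hp : (term K hK k).1 = Equiv.swap 0 1 := by rw [term_fst]; unfold perm; rw [if_pos hsw]
    rw [cost_swap d _ hp]
    show bV K d (cls0 K k) + bV K d (cls1 K k) = Cst K d k
    obtain ⟨h0, h1⟩ := cls_even (K := K) hsw.1 (by omega)
    rw [h0, h1, ← two_mul, two_mul_bV, show 2 * ((k : ℕ) / 2) = (k : ℕ) by omega]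
  · have hp : (term K hK k).1 = 1 := by rw [term_fst]; unfold perm; rw [if_neg hsw]
    rw [cost_id d _ hp]
    show aV K d (cls0 K k) + cV K d (cls1 K k) = Cst K d k
    by_cases hl : 2 * K ≤ (k : ℕ) + 3
    · obtain ⟨h0, h1⟩ := cls_late (K := K) hl
      rw [h0, h1, cV_ne_zero d (show K - 1 ≠ 0 by omega)]
      unfold aV
      rw [show 2 * K - 3 + ((k : ℕ) + 3 - 2 * K) = k by omega, show 2 * (K - 1) - 1 = 2 * K - 3 by omega]; ring
    · have hodd_or : (k : ℕ) % 2 = 1 ∨ (k : ℕ) = 0 := by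
        by_contra hcon; push Not at hcon; exact hsw ⟨hl, by omega, hcon.2⟩
      rcases hodd_or with ho | h0
      · obtain ⟨h0, h1⟩ := cls_odd (K := K) hl ho
        rw [h0, h1, aV_zero, cV_ne_zero d (show ((k : ℕ) + 1) / 2 ≠ 0 by omega), zero_add,
          show 2 * (((k : ℕ) + 1) / 2) - 1 = k by omega]
      · obtain ⟨hc0, hc1⟩ := cls_even (K := K) hl (by omega)
        rw [hc0, hc1, h0, Nat.zero_div, aV_zero, cV_zero, add_zero]; rfl

/-- sign of chain term `k` is `−(−1)ᵏ`. -/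
theorem termSign_term (k : Fin (3 * K - 4 + 1)) : termSign (ee K) (term K hK k) = -(-1) ^ (k : ℕ) := by
  have hk : (k : ℕ) ≤ 3 * K - 4 := by have := k.isLt; omega
  by_cases hsw : ¬ (2 * K ≤ (k : ℕ) + 3) ∧ (k : ℕ) % 2 = 0 ∧ (k : ℕ) ≠ 0
  · have hp : (term K hK k).1 = Equiv.swap 0 1 := by rw [term_fst]; unfold perm; rw [if_pos hsw]
    rw [termSign_swap _ hp, ee_off10, ee_off01, term_cls0, term_cls1]
    obtain ⟨h0, h1⟩ := cls_even (K := K) hsw.1 (by omega)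
    rw [h0, h1, if_pos (by omega)]
    obtain ⟨y, hy⟩ : ∃ y, (k : ℕ) = 2 * y := ⟨(k : ℕ) / 2, by omega⟩
    rw [hy, pow_mul]; norm_num
  · have hp : (term K hK k).1 = 1 := by rw [term_fst]; unfold perm; rw [if_neg hsw]
    rw [termSign_id _ hp, term_cls0, term_cls1]
    by_cases hl : 2 * K ≤ (k : ℕ) + 3
    · obtain ⟨h0, h1⟩ := cls_late (K := K) hl
      rw [h0, h1, if_neg (by omega), mul_one]
      obtain ⟨x, hx⟩ : ∃ x, (k : ℕ) = 2 * K - 3 + x := ⟨(k : ℕ) + 3 - 2 * K, by omega⟩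
      rw [show (k : ℕ) + 3 - 2 * K = x by omega, hx, pow_add,
        show 2 * K - 3 = 2 * (K - 2) + 1 by omega, pow_succ, pow_mul]; norm_num
    · have hodd_or : (k : ℕ) % 2 = 1 ∨ (k : ℕ) = 0 := by
        by_contra hcon; push Not at hcon; exact hsw ⟨hl, by omega, hcon.2⟩
      rcases hodd_or with ho | h0
      · obtain ⟨h0, h1⟩ := cls_odd (K := K) hl ho
        rw [h0, h1, if_neg (by omega), pow_zero, one_mul]
        obtain ⟨y, hy⟩ : ∃ y, (k : ℕ) = 2 * y + 1 := ⟨(k : ℕ) / 2, by omega⟩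
        rw [hy, pow_succ, pow_mul]; norm_num
      · obtain ⟨hc0, hc1⟩ := cls_even (K := K) hl (by omega)
        rw [hc0, hc1, h0, Nat.zero_div, if_pos rfl]; norm_num

/-- chain terms are present. -/
theorem termSign_term_ne_zero (k : Fin (3 * K - 4 + 1)) : termSign (ee K) (term K hK k) ≠ 0 := by
  rw [termSign_term]
  exact neg_ne_zero.mpr (pow_ne_zero _ (by norm_num))

/-- consecutive chain terms have opposite signs. -/
theorem alt_term (k : Fin (3 * K - 4)) :
    termSign (ee K) (term K hK k.castSucc) * termSign (ee K) (term K hK k.succ) < 0 := by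
  rw [termSign_term, termSign_term, Fin.val_succ, Fin.val_castSucc, pow_succ]
  have h : ((-1 : ℤ) ^ (k : ℕ)) ^ 2 = 1 := by rw [← pow_mul, mul_comm, pow_mul]; norm_num
  nlinarith [h]

end chain

/-! ## 2. Off-chain present terms lie strictly above a chord -/

section offchain
variable (hK : 3 ≤ K) {d : Fin K → ℕ} (hd : ∀ l l' : Fin K, l < l' → 2 * d l < d l')
include hK hd

omit hK hd in
/-- the packaged chord witness at the chain interval `[X j, X (j+1)]`. -/
theorem chord_witness (q : Equiv.Perm (Fin 2) × (Fin 2 → Fin K)) (j : ℕ) (hj : j + 1 ≤ 3 * K - 4)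
    (h1 : X K d j ≤ TropicalCensus.slope d q) (h2 : TropicalCensus.slope d q ≤ X K d (j + 1))
    (h3 : Cst K d j + 4 ^ (j + 1) * (TropicalCensus.slope d q - X K d j) < ∑ i, vv K d (q.1 i) i (q.2 i)) :
    ∃ j : Fin (3 * K - 4), (fun k : Fin (3 * K - 4 + 1) => X K d k) j.castSucc ≤ TropicalCensus.slope d q ∧
      TropicalCensus.slope d q ≤ (fun k : Fin (3 * K - 4 + 1) => X K d k) j.succ ∧
      (fun k : Fin (3 * K - 4 + 1) => Cst K d k) j.castSucc +
        (fun k : Fin (3 * K - 4 + 1) => (4 : ℤ) ^ (k : ℕ)) j.succ *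
          (TropicalCensus.slope d q - (fun k : Fin (3 * K - 4 + 1) => X K d k) j.castSucc) <
        ∑ i, vv K d (q.1 i) i (q.2 i) :=
  ⟨⟨j, by omega⟩, h1, h2, h3⟩

/-- identity terms off the hook: classes `(x, y)` with `1 ≤ x` and `y ≤ K − 2`. -/
theorem off_id (x y : ℕ) (hx1 : 1 ≤ x) (hxK : x ≤ K - 1) (hyK : y + 2 ≤ K)
    (q : Equiv.Perm (Fin 2) × (Fin 2 → Fin K)) (hq : q.1 = 1) (hq0 : ((q.2 0 : Fin K) : ℕ) = x)
    (hq1 : ((q.2 1 : Fin K) : ℕ) = y) :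
    ∃ j : Fin (3 * K - 4), (fun k : Fin (3 * K - 4 + 1) => X K d k) j.castSucc ≤ TropicalCensus.slope d q ∧
      TropicalCensus.slope d q ≤ (fun k : Fin (3 * K - 4 + 1) => X K d k) j.succ ∧
      (fun k : Fin (3 * K - 4 + 1) => Cst K d k) j.castSucc +
        (fun k : Fin (3 * K - 4 + 1) => (4 : ℤ) ^ (k : ℕ)) j.succ *
          (TropicalCensus.slope d q - (fun k : Fin (3 * K - 4 + 1) => X K d k) j.castSucc) <
        ∑ i, vv K d (q.1 i) i (q.2 i) := by
  have hs : TropicalCensus.slope d q = dN K d x + dN K d y := by rw [slope_two, hq0, hq1]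
  have hc : ∑ i, vv K d (q.1 i) i (q.2 i) = aV K d x + cV K d y := by rw [cost_id d q hq, hq0, hq1]
  have hxpos : 0 < dN K d x - dN K d 0 := by have := dN_lt hd (show 0 < x by omega) (by omega); linarith
  have haV := le_aV hd hK hxK
  have h4pos : (0 : ℤ) < 4 := by norm_num
  rcases Nat.lt_or_ge x K with _ | _
  swap; · exfalso; omega
  by_cases hxK1 : x = K - 1
  · -- (d): twin of the chain term `id (y, K−1)`: slope `X (2K−3+y)`, interval `j = 2K − 4 + y`
    subst hxK1
    have hsX : TropicalCensus.slope d q = X K d (2 * K - 4 + y + 1) := by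
      rw [hs, show 2 * K - 4 + y + 1 = 2 * K - 3 + y by omega, X_late (by omega), add_comm]
    refine chord_witness q (2 * K - 4 + y) (by omega) ?_ (le_of_eq hsX) ?_
    · rw [hsX]; exact (X_lt_succ hd hK (by omega)).le
    · rw [hsX, ← Cst_succ, hc, show 2 * K - 4 + y + 1 = 2 * K - 3 + y by omega]
      -- `Cst (2K−3+y) < aV (K−1) + cV y`
      unfold aV cV
      have hlo := le_Cst_sub hd hK (show 2 * K - 3 + y ≤ 2 * K - 3 + (K - 1) by omega) (by omega)
      rw [X_late (by omega), X_late (by omega)] at hlo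
      have hdy : 0 < dN K d (K - 1) - dN K d y := by have := dN_lt hd (show y < K - 1 by omega) (by omega); linarith
      by_cases hy0 : y = 0
      · subst hy0
        rw [if_pos rfl, Nat.add_zero]
        simp only [Nat.add_zero] at hlo
        have hup := Cst_sub_le hd hK (show 0 ≤ 2 * K - 3 by omega) (by omega)
        rw [X_late0 (by omega), X_zero (by omega), Cst_zero, sub_zero] at hup
        have hpow : (4 : ℤ) ^ (2 * K - 3) < 4 ^ (2 * K - 3 + 1) := pow_lt_pow_right₀ (by norm_num) (by omega)
        nlinarith [mul_lt_mul_of_pos_right hpow hdy, dN_nonneg (K := K) (d := d) 0]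
      · rw [if_neg hy0]
        have hup := Cst_sub_le hd hK (show 2 * y - 1 ≤ 2 * K - 3 by omega) (by omega)
        rw [X_late0 (by omega), X_odd hK (by omega) (by omega)] at hup
        have hpow : (4 : ℤ) ^ (2 * K - 3) < 4 ^ (2 * K - 3 + y + 1) := pow_lt_pow_right₀ (by norm_num) (by omega)
        nlinarith [mul_lt_mul_of_pos_right hpow hdy]
  · have hxK2 : x + 2 ≤ K := by omega
    rcases lt_trichotomy x y with hxy | rfl | hyx
    · -- (a): `1 ≤ x < y ≤ K−2`, interval `j = 2y − 1`
      have hy1 : 1 ≤ y := by omega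
      refine chord_witness q (2 * y - 1) (by omega) ?_ ?_ ?_
      · rw [hs, X_odd hK hy1 (by omega)]; linarith [hxpos]
      · rw [hs, show 2 * y - 1 + 1 = 2 * y by omega, X_even hyK]
        have := dN_lt hd hxy (by omega); linarith
      · rw [hs, hc, X_odd hK hy1 (by omega), show 2 * y - 1 + 1 = 2 * y by omega]
        unfold cV; rw [if_neg (by omega)]
        have hpow : (4 : ℤ) ^ (2 * y) < 4 ^ (2 * K - 2) := pow_lt_pow_right₀ (by norm_num) (by omega)
        nlinarith [mul_lt_mul_of_pos_right hpow hxpos]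
    · -- (b): `1 ≤ x = y ≤ K−2`, twin of the transposition term `(y,y)`: right endpoint of interval `j = 2x − 1`
      refine chord_witness q (2 * x - 1) (by omega) ?_ ?_ ?_
      · rw [hs, X_odd hK hx1 (by omega)]; linarith [hxpos]
      · rw [hs, show 2 * x - 1 + 1 = 2 * x by omega, X_even hxK2]; linarith
      · rw [hs, hc, X_odd hK hx1 (by omega), show 2 * x - 1 + 1 = 2 * x by omega]
        unfold cV; rw [if_neg (by omega)]
        have hpow : (4 : ℤ) ^ (2 * x) < 4 ^ (2 * K - 2) := pow_lt_pow_right₀ (by norm_num) (by omega)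
        nlinarith [mul_lt_mul_of_pos_right hpow hxpos]
    · -- (c): `y < x ≤ K−2`, interval `j = 2x − 1`
      refine chord_witness q (2 * x - 1) (by omega) ?_ ?_ ?_
      · rw [hs, X_odd hK hx1 (by omega)]
        have := dN_le hd (show 0 ≤ y from Nat.zero_le y) (by omega); linarith
      · rw [hs, show 2 * x - 1 + 1 = 2 * x by omega, X_even hxK2]
        have := dN_lt hd hyx (by omega); linarith
      · rw [hs, hc, X_odd hK hx1 (by omega), show 2 * x - 1 + 1 = 2 * x by omega]
        have hpow : (4 : ℤ) ^ (2 * x) < 4 ^ (2 * K - 2) := pow_lt_pow_right₀ (by norm_num) (by omega)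
        have hpow' : (4 : ℤ) ^ (2 * x - 1) ≤ 4 ^ (2 * x) := pow_le_pow_right₀ (by norm_num) (by omega)
        unfold cV
        by_cases hy0 : y = 0
        · subst hy0
          rw [if_pos rfl]
          have hup := Cst_sub_le hd hK (show 0 ≤ 2 * x - 1 by omega) (by omega)
          rw [X_odd hK hx1 (by omega), X_zero (by omega), Cst_zero, sub_zero] at hup
          nlinarith [mul_lt_mul_of_pos_right hpow hxpos, mul_le_mul_of_nonneg_right hpow' hxpos.le]
        · rw [if_neg hy0]
          have hup := Cst_sub_le hd hK (show 2 * y - 1 ≤ 2 * x - 1 by omega) (by omega)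
          rw [X_odd hK hx1 (by omega), X_odd hK (by omega) (by omega)] at hup
          have hdyx : 0 ≤ dN K d x - dN K d y := by have := dN_lt hd hyx (by omega); linarith
          have hdy0 : 0 ≤ dN K d y - dN K d 0 := by have := dN_le hd (Nat.zero_le y) (by omega); linarith
          nlinarith [mul_lt_mul_of_pos_right hpow hxpos, mul_le_mul_of_nonneg_right hpow' hdyx,
            mul_nonneg (show (0:ℤ) ≤ 4 ^ (2 * x) by positivity) hdy0]

/-- transposition terms off the diagonal: classes `l ≠ l'` in `1 … K−2`. -/
theorem off_swap (l l' : ℕ) (hl : 1 ≤ l ∧ l + 2 ≤ K) (hl' : 1 ≤ l' ∧ l' + 2 ≤ K) (hne : l ≠ l')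
    (q : Equiv.Perm (Fin 2) × (Fin 2 → Fin K)) (hq : q.1 = Equiv.swap 0 1) (hq0 : ((q.2 0 : Fin K) : ℕ) = l)
    (hq1 : ((q.2 1 : Fin K) : ℕ) = l') :
    ∃ j : Fin (3 * K - 4), (fun k : Fin (3 * K - 4 + 1) => X K d k) j.castSucc ≤ TropicalCensus.slope d q ∧
      TropicalCensus.slope d q ≤ (fun k : Fin (3 * K - 4 + 1) => X K d k) j.succ ∧
      (fun k : Fin (3 * K - 4 + 1) => Cst K d k) j.castSucc +
        (fun k : Fin (3 * K - 4 + 1) => (4 : ℤ) ^ (k : ℕ)) j.succ *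
          (TropicalCensus.slope d q - (fun k : Fin (3 * K - 4 + 1) => X K d k) j.castSucc) <
        ∑ i, vv K d (q.1 i) i (q.2 i) := by
  have hc2 : 2 * ∑ i, vv K d (q.1 i) i (q.2 i) = Cst K d (2 * l) + Cst K d (2 * l') := by
    rw [cost_swap d q hq, hq0, hq1, mul_add, two_mul_bV, two_mul_bV]
  -- order the two classes
  obtain ⟨lo, hi, hlo, hhi, hlt, hs, hc⟩ : ∃ lo hi : ℕ, (1 ≤ lo ∧ lo + 2 ≤ K) ∧ (1 ≤ hi ∧ hi + 2 ≤ K) ∧ lo < hi ∧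
      TropicalCensus.slope d q = dN K d lo + dN K d hi ∧
      2 * ∑ i, vv K d (q.1 i) i (q.2 i) = Cst K d (2 * lo) + Cst K d (2 * hi) := by
    rcases lt_or_gt_of_ne hne with h | h
    · exact ⟨l, l', hl, hl', h, by rw [slope_two, hq0, hq1], hc2⟩
    · exact ⟨l', l, hl', hl, h, by rw [slope_two, hq0, hq1, add_comm], by rw [hc2, add_comm]⟩
  have hpos : 0 < dN K d hi + dN K d 0 - 2 * dN K d lo := by
    have := dN_tower hd hlt (by omega); have := dN_nonneg (K := K) (d := d) 0; linarith
  have hlo0 : 0 < dN K d lo - dN K d 0 := by have := dN_lt hd (show 0 < lo by omega) (by omega); linarith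
  refine chord_witness q (2 * hi - 1) (by omega) ?_ ?_ ?_
  · rw [hs, X_odd hK hhi.1 (by omega)]; linarith
  · rw [hs, show 2 * hi - 1 + 1 = 2 * hi by omega, X_even hhi.2]
    have := dN_lt hd hlt (by omega); linarith
  · rw [hs, X_odd hK hhi.1 (by omega), show 2 * hi - 1 + 1 = 2 * hi by omega]
    -- double both sides: `2·Cst(2hi−1) + 2·4^{2hi}(d_lo − d₀) < Cst(2lo) + Cst(2hi)`
    have hstep : Cst K d (2 * hi) = Cst K d (2 * hi - 1) + 4 ^ (2 * hi) * (2 * dN K d hi - (dN K d 0 + dN K d hi)) := by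
      have := Cst_succ (K := K) (d := d) (2 * hi - 1)
      rw [show 2 * hi - 1 + 1 = 2 * hi by omega, X_even hhi.2, X_odd hK hhi.1 (by omega)] at this
      exact this
    have hup := Cst_sub_le hd hK (show 2 * lo ≤ 2 * hi - 1 by omega) (by omega)
    rw [X_odd hK hhi.1 (by omega), X_even hlo.2] at hup
    have hpow : (4 : ℤ) ^ (2 * hi - 1) < 4 ^ (2 * hi) := pow_lt_pow_right₀ (by norm_num) (by omega)
    nlinarith [mul_lt_mul_of_pos_right hpow hpos]

/-- **every present off-chain term lies strictly above a chord of the chain.** -/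
theorem off_chain (q : Equiv.Perm (Fin 2) × (Fin 2 → Fin K)) (hq : termSign (ee K) q ≠ 0)
    (hch : ∀ k, q ≠ term K hK k) :
    ∃ j : Fin (3 * K - 4), (fun k : Fin (3 * K - 4 + 1) => X K d k) j.castSucc ≤ TropicalCensus.slope d q ∧
      TropicalCensus.slope d q ≤ (fun k : Fin (3 * K - 4 + 1) => X K d k) j.succ ∧
      (fun k : Fin (3 * K - 4 + 1) => Cst K d k) j.castSucc +
        (fun k : Fin (3 * K - 4 + 1) => (4 : ℤ) ^ (k : ℕ)) j.succ *
          (TropicalCensus.slope d q - (fun k : Fin (3 * K - 4 + 1) => X K d k) j.castSucc) <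
        ∑ i, vv K d (q.1 i) i (q.2 i) := by
  have hx : ((q.2 0 : Fin K) : ℕ) < K := (q.2 0).isLt
  have hy : ((q.2 1 : Fin K) : ℕ) < K := (q.2 1).isLt
  set x := ((q.2 0 : Fin K) : ℕ) with hxdef
  set y := ((q.2 1 : Fin K) : ℕ) with hydef
  rcases perm_two q.1 with hσ | hσ
  · -- identity term: off the hook, or it would be a chain term
    have hx1 : 1 ≤ x := by
      by_contra h0
      have hx0 : x = 0 := by omega
      by_cases hy0 : y = 0
      · refine hch ⟨0, by omega⟩ (eq_term hK q 0 (by omega) ?_ ?_ ?_)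
        · rw [hσ]; unfold perm; rw [if_neg (by omega)]
        · rw [← hxdef, hx0]; unfold cls0; rw [if_neg (by omega), if_neg (by omega)]
        · rw [← hydef, hy0]; unfold cls1; rw [if_neg (by omega), if_neg (by omega)]
      · refine hch ⟨2 * y - 1, by omega⟩ (eq_term hK q (2 * y - 1) (by omega) ?_ ?_ ?_)
        · rw [hσ]; unfold perm; rw [if_neg (by omega)]
        · rw [← hxdef, hx0]; unfold cls0; split_ifs <;> omega
        · rw [← hydef]; unfold cls1; split_ifs <;> omega
    have hyK : y + 2 ≤ K := by
      by_contra h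
      have hyK1 : y = K - 1 := by omega
      refine hch ⟨2 * K - 3 + x, by omega⟩ (eq_term hK q (2 * K - 3 + x) (by omega) ?_ ?_ ?_)
      · rw [hσ]; unfold perm; rw [if_neg (by omega)]
      · rw [← hxdef]; unfold cls0; rw [if_pos (by omega)]; omega
      · rw [← hydef, hyK1]; unfold cls1; rw [if_pos (by omega)]
    exact off_id hK hd x y hx1 (by omega) hyK q hσ rfl rfl
  · -- transposition term: present ⇒ both classes in `1 … K−2`; off the diagonal, or it would be a chain term
    rw [termSign_swap q hσ, ee_off10, ee_off01] at hq
    have hl : 1 ≤ x ∧ x + 2 ≤ K := by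
      by_contra hcon; apply hq; rw [← hxdef, if_neg hcon]; ring
    have hl' : 1 ≤ y ∧ y + 2 ≤ K := by
      by_contra hcon; apply hq; rw [← hydef, if_neg hcon]; ring
    have hne : x ≠ y := by
      intro hxy
      refine hch ⟨2 * x, by omega⟩ (eq_term hK q (2 * x) (by omega) ?_ ?_ ?_)
      · rw [hσ]; unfold perm; rw [if_pos ⟨by omega, by omega, by omega⟩]
      · rw [← hxdef]; unfold cls0; rw [if_neg (by omega), if_neg (by omega)]; omega
      · rw [← hydef, ← hxy]; unfold cls1; rw [if_neg (by omega), if_neg (by omega)]; omega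
    exact off_swap hK hd x y hl hl' hne q hσ rfl rfl

end offchain

/-! ## 3. The symmetric chain on every 2-tower, and the real floor `ζ₊(2; d) ≥ 3K − 4` -/

/-- ★ **THE SYMMETRIC `m = 2` TROPICAL OPTIMUM ON EVERY 2-TOWER**: a symmetric `2 × 2` dominance design on the 2-tower `d` (`K ≥ 3`) with
`3K − 4` sign-alternating uniquely dominant breakpoints at strictly increasing integer slopes. [this work] -/
theorem exists_symm_chain (hK : 3 ≤ K) (d : Fin K → ℕ) (hd : ∀ l l' : Fin K, l < l' → 2 * d l < d l') :
    ∃ (v ε : Fin 2 → Fin 2 → Fin K → ℤ), (∀ i j l, v i j l = v j i l) ∧ (∀ i j l, ε i j l = ε j i l) ∧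
      (∀ i j l, (ε i j l).natAbs ≤ 1) ∧
      ∃ (θ : Fin (3 * K - 4 + 1) → ℤ) (p : Fin (3 * K - 4 + 1) → Equiv.Perm (Fin 2) × (Fin 2 → Fin K)),
        StrictMono θ ∧ (∀ k, IsDominant d v ε (θ k) (p k)) ∧
        (∀ k : Fin (3 * K - 4), termSign ε (p k.castSucc) * termSign ε (p k.succ) < 0) := by
  obtain ⟨θ, hθ, hdom⟩ := isDominant_of_envelope d (vv K d) (ee K) (term K hK)
    (fun k => X K d k) (fun k => Cst K d k) (fun k => (4 : ℤ) ^ (k : ℕ))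
    (slope_term hK d) (cost_term hK d)
    (by
      rw [Fin.strictMono_iff_lt_succ]; intro k
      simp only [Fin.val_succ, Fin.val_castSucc]
      exact X_lt_succ hd hK (by have := k.isLt; omega))
    (by
      intro k; simp only [Fin.val_succ, Fin.val_castSucc, pow_succ]
      have : (1 : ℤ) ≤ 4 ^ (k : ℕ) := one_le_pow₀ (by norm_num)
      linarith)
    (by intro k; simp only [Fin.val_succ, Fin.val_castSucc]; exact Cst_succ _)
    (termSign_term_ne_zero hK) (off_chain hK hd)
  exact ⟨vv K d, ee K, vv_symm d, ee_symm, ee_natAbs, θ, term K hK, hθ, hdom, alt_term hK⟩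

/-- ★★ **`ζ₊(2; d) ≥ 3K − 4` ON EVERY 2-TOWER** (`K ≥ 3`): some real symmetric `2 × 2` lacunary pencil on the 2-tower `d` has at least
`3K − 4` distinct positive determinant zeros (symmetric patchworking of `exists_symm_chain`), so `¬ PosRootLawOn 2 K (3K − 5) d`.
The tree's all-support floor was the diagonal `2K − 2` (`DescartesSharp.le_of_posRootLawOn`). [this work] -/
theorem not_posRootLawOn_two_tower (hK : 3 ≤ K) (d : Fin K → ℕ) (hd : ∀ l l' : Fin K, l < l' → 2 * d l < d l') :
    ¬ PosRootLawOn 2 K (3 * K - 5) d := by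
  obtain ⟨v, ε, hv, hεs, hε, θ, p, hθ, hdom, halt⟩ := exists_symm_chain hK d hd
  intro hlaw
  have hle := le_card_posRoots_patchMatrix d v ε hε θ hθ p hdom halt
  have hB := hlaw (patchMatrix ((Fintype.card (Equiv.Perm (Fin 2) × (Fin 2 → Fin K)) : ℝ) + 1) v ε)
    (patchMatrix_isSymm _ v ε hv hεs)
  omega

/-- positive form: every valid size-`2` class budget on a 2-tower with `K ≥ 3` letters is at least `3K − 4`. [this work] -/
theorem le_of_posRootLawOn_two_tower (hK : 3 ≤ K) {d : Fin K → ℕ} (hd : ∀ l l' : Fin K, l < l' → 2 * d l < d l') {B : ℕ}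
    (h : PosRootLawOn 2 K B d) : 3 * K - 4 ≤ B := by
  by_contra hB
  exact not_posRootLawOn_two_tower hK d hd (fun S hS => (h S hS).trans (by omega))

end TowerRowTwoSym

end Summit.ValiantsHypothesis.ValiantsHypothesis.Theorems.KPlusLogSqLaw.TowerGraft
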